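import Summits.ResolutionOfSingularities.ResolutionOfSingularities.Theorems.FrobeniusClosingSteerToricExitProducer
import HarnessLib

/-!
# Crux `Steer` (stmt-ResolutionOfSingularities-16345) — TORIC EXIT AT A DOMINANT VERTEX, part 1: PAIR BLOW-UPS DECIDED BY THE
# VALUATION (admissible re-letterings)

OURS (campaign res-hironaka, rung L ★L-G4, slot W4.1; res-D-brk-2 g6 on res-L0-w41-plan-1 RULING 229 (d), E-ROW #3; signature file
`D/res-D-brk-2/K_W9_signature.lean` 40590a5e08b7c948). Candidates, not facts; NOT a statement of H. Hironaka's manuscript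
[claim: Hironaka2017, status: under-review]; AI formalisation, weaker than expert review; `--supports stmt-ResolutionOfSingularities-16345`,
counted 0. Definition-free.

## What is proved (any fields `k ⊆ K`, any valuation subring `O` of `K`; no characteristic hypothesis)

Letters `z : Fin n → K`, all `≠ 0`; Laurent monomials `z^f = ∏ j, z j ^ f j` (`f : Fin n → ℤ`).

* **Pair blow-up** (`§1`): for `a ≠ b` the letters `z' := update z b (z b / z a)` (i.e. `z_b = z_a · z'_b`) satisfy
  `z' ^ (shift a b f) = z ^ f` for EVERY exponent vector, `shift a b f = f + f b • δ_a` (`prod_zpow_update_shift`); `shift` is additive,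
  preserves `ℕ`-vectors and preserves «some coordinate is odd»; `k(z') = k(z)`.
* **Admissible re-lettering** (`§2`, the bookkeeping predicate `Relettering O z z' T`): all `z'_j ∈ O ∖ 0`, `k(z') = k(z)`, and an
  exponent transformer `T` with `z' ^ (T f) = z ^ f`, `T (-f) = -T f`, `T` preserving `ℕ`-vectors and odd coordinates. Reflexive,
  transitive, and produced by ONE pair blow-up in the orientation the valuation dictates (`Relettering.step`: `z_b/z_a ∈ O` or
  `z_a/z_b ∈ O` by totality of the value group).
* **Perron monomialisation along `O`** (`§3`–`§4`): for every exponent vector `e` there is an admissible re-lettering after which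
  `T e ≥ 0` or `T e ≤ 0` coordinatewise (`exists_relettering_uniform`); hence a Laurent monomial of value `< 1` (i.e. in `𝔪_O`)
  becomes an `ℕ`-MONOMIAL in the new letters (`exists_relettering_nonneg`), and finitely many at once
  (`exists_relettering_nonneg_family`). TERMINATION (the valuation only chooses branches, Lean never enumerates the tree): strategy
  «pair a letter of maximal `|e_j|` with a letter of the opposite sign» and the potential lex(`M` = max `|e_j|`, `c` = number of
  `j` with `|e_j| = M`, `m` = number of `j` whose sign is opposite to the sign of the `M`-letters) — three nested inductions.

Part 2 (`…SteerToricVertexExit`) adds the odd-support reduction and the Jacobian chart; part 3 (`…SteerW9WitnessConcl`) the W9′ datum.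
[cite: Teissier2014] [folklore] (Perron / Zariski pair transformations; the statement here is the elementary exponent game, OURS.)
-/

noncomputable section

-- single-problem summit: the doubled namespace component `ResolutionOfSingularities` is forced
set_option linter.dupNamespace false

open scoped BigOperators

namespace Summit.ResolutionOfSingularities.ResolutionOfSingularities.Theorems.SteerToricVertexSplit

variable {k K : Type} [Field k] [Field K] [Algebra k K]

/-! ## §1 The exponent shift and the pair blow-up -/

section Shift

variable {n : ℕ}

/-- The shift `f ↦ update f a (f a + f b)` (exponent transformer of the pair blow-up `z_b = z_a · z'_b`) is compatible with
negation. [folklore] -/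
theorem shift_neg (a b : Fin n) (f : Fin n → ℤ) :
    Function.update (-f) a ((-f) a + (-f) b) = -Function.update f a (f a + f b) := by
  funext j
  by_cases h : j = a
  · subst h; simp only [Function.update_self, Pi.neg_apply]; ring
  · simp only [Function.update_of_ne h, Pi.neg_apply]

/-- The shift preserves coordinatewise non-negativity. [folklore] -/
theorem shift_nonneg (a b : Fin n) {f : Fin n → ℤ} (hf : ∀ j, 0 ≤ f j) (j : Fin n) :
    0 ≤ Function.update f a (f a + f b) j := by
  by_cases h : j = a
  · subst h; rw [Function.update_self]; exact add_nonneg (hf _) (hf _)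
  · rw [Function.update_of_ne h]; exact hf j

/-- The shift preserves «some coordinate is odd» (`a ≠ b`). [folklore] -/
theorem shift_odd {a b : Fin n} (hab : a ≠ b) {f : Fin n → ℤ} (hf : ∃ j, Odd (f j)) :
    ∃ j, Odd (Function.update f a (f a + f b) j) := by
  by_cases hb : Odd (f b)
  · exact ⟨b, by rw [Function.update_of_ne hab.symm]; exact hb⟩
  · obtain ⟨j, hj⟩ := hf
    by_cases h : j = a
    · subst h
      refine ⟨j, ?_⟩
      rw [Function.update_self]
      exact Int.odd_add.mpr ⟨fun _ => Int.not_odd_iff_even.mp hb, fun _ => hj⟩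
    · exact ⟨j, by rw [Function.update_of_ne h]; exact hj⟩

/-- **The pair blow-up identity**: with `z'_b = z_b / z_a` (and `z'_j = z_j` otherwise), `z' ^ (update f a (f a + f b)) = z ^ f` for every
Laurent exponent `f` (`z_j ≠ 0`, `a ≠ b`). [folklore] -/
theorem prod_zpow_update_shift (z : Fin n → K) (hz0 : ∀ j, z j ≠ 0) {a b : Fin n} (hab : a ≠ b) (f : Fin n → ℤ) :
    (∏ j, Function.update z b (z b / z a) j ^ Function.update f a (f a + f b) j) = ∏ j, z j ^ f j := by
  classical
  have key : ∀ j, Function.update z b (z b / z a) j ^ Function.update f a (f a + f b) j =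
      Function.update (fun j => z j ^ f j) b ((z b / z a) ^ f b) j * (if j = a then z a ^ f b else 1) := by
    intro j
    by_cases hjb : j = b
    · subst hjb
      rw [Function.update_self, Function.update_self, Function.update_of_ne hab.symm, if_neg hab.symm, mul_one]
    · rw [Function.update_of_ne hjb, Function.update_of_ne hjb]
      by_cases hja : j = a
      · subst hja
        rw [Function.update_self, if_pos rfl, zpow_add₀ (hz0 j)]
      · rw [Function.update_of_ne hja, if_neg hja, mul_one]
  rw [Finset.prod_congr rfl fun j _ => key j, Finset.prod_mul_distrib, Finset.prod_update_of_mem (Finset.mem_univ b),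
    Finset.prod_ite_eq' Finset.univ a, if_pos (Finset.mem_univ a),
    Finset.prod_eq_mul_prod_sdiff_singleton_of_mem (Finset.mem_univ b) (fun j => z j ^ f j)]
  rw [div_zpow, mul_assoc, mul_comm _ (z a ^ f b), ← mul_assoc, div_mul_cancel₀ _ (zpow_ne_zero _ (hz0 a))]

/-- After a pair blow-up all letters are still non-zero. [folklore] -/
theorem update_div_ne_zero (z : Fin n → K) (hz0 : ∀ j, z j ≠ 0) (a b j : Fin n) :
    Function.update z b (z b / z a) j ≠ 0 := by
  by_cases h : j = b
  · subst h; rw [Function.update_self]; exact div_ne_zero (hz0 j) (hz0 a)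
  · rw [Function.update_of_ne h]; exact hz0 j

/-- After a pair blow-up the letters generate the same subfield over `k`. [folklore] -/
theorem adjoin_update_div (z : Fin n → K) (hz0 : ∀ j, z j ≠ 0) {a b : Fin n} (hab : a ≠ b) :
    IntermediateField.adjoin k (Set.range (Function.update z b (z b / z a))) = IntermediateField.adjoin k (Set.range z) := by
  apply le_antisymm
  · apply IntermediateField.adjoin_le_iff.mpr
    rintro _ ⟨j, rfl⟩
    by_cases h : j = b
    · subst h
      rw [Function.update_self]
      exact div_mem (IntermediateField.subset_adjoin _ _ ⟨j, rfl⟩) (IntermediateField.subset_adjoin _ _ ⟨a, rfl⟩)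
    · rw [Function.update_of_ne h]
      exact IntermediateField.subset_adjoin _ _ ⟨j, rfl⟩
  · apply IntermediateField.adjoin_le_iff.mpr
    rintro _ ⟨j, rfl⟩
    by_cases h : j = b
    · subst h
      have hm : Function.update z j (z j / z a) j * Function.update z j (z j / z a) a ∈
          IntermediateField.adjoin k (Set.range (Function.update z j (z j / z a))) :=
        mul_mem (IntermediateField.subset_adjoin _ _ ⟨j, rfl⟩) (IntermediateField.subset_adjoin _ _ ⟨a, rfl⟩)
      have e : Function.update z j (z j / z a) j * Function.update z j (z j / z a) a = z j := by
        rw [Function.update_self, Function.update_of_ne hab, div_mul_cancel₀ _ (hz0 a)]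
      rw [e] at hm
      exact hm
    · have hm : Function.update z b (z b / z a) j ∈ IntermediateField.adjoin k (Set.range (Function.update z b (z b / z a))) :=
        IntermediateField.subset_adjoin _ _ ⟨j, rfl⟩
      rw [Function.update_of_ne h] at hm
      exact hm

/-- After a pair blow-up in the orientation `z_b / z_a ∈ O` all letters stay in `O`. [folklore] -/
theorem update_div_mem (O : ValuationSubring K) (z : Fin n → K) (hzO : ∀ j, z j ∈ O) {a b : Fin n}
    (h : z b / z a ∈ O) (j : Fin n) : Function.update z b (z b / z a) j ∈ O := by
  by_cases hj : j = b
  · subst hj; rw [Function.update_self]; exact h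
  · rw [Function.update_of_ne hj]; exact hzO j

end Shift

/-! ## §2 Admissible re-letterings -/

section Relettering

variable {n : ℕ}

/-- **Admissible re-lettering** of `z` into `z'` with exponent transformer `T` along `O` (bookkeeping conjunction, OURS): the new
letters lie in `O ∖ 0` and generate the same subfield over `k`, `T` re-expresses every Laurent monomial (`z' ^ (T f) = z ^ f`),
commutes with negation, preserves `ℕ`-vectors and preserves «some coordinate is odd». [folklore] -/
def Relettering (k : Type) [Field k] [Algebra k K] (O : ValuationSubring K) (z z' : Fin n → K)
    (T : (Fin n → ℤ) → (Fin n → ℤ)) : Prop :=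
  (∀ j, z' j ∈ O) ∧ (∀ j, z' j ≠ 0) ∧
    IntermediateField.adjoin k (Set.range z') = IntermediateField.adjoin k (Set.range z) ∧
    (∀ f, (∏ j, z' j ^ T f j) = ∏ j, z j ^ f j) ∧ (∀ f, T (-f) = -T f) ∧
    (∀ f : Fin n → ℤ, (∀ j, 0 ≤ f j) → ∀ j, 0 ≤ T f j) ∧ (∀ f : Fin n → ℤ, (∃ j, Odd (f j)) → ∃ j, Odd (T f j))

/-- Reflexivity of re-lettering. [folklore] -/
theorem relettering_refl (O : ValuationSubring K) (z : Fin n → K) (hzO : ∀ j, z j ∈ O) (hz0 : ∀ j, z j ≠ 0) :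
    Relettering k O z z id :=
  ⟨hzO, hz0, rfl, fun _ => rfl, fun _ => rfl, fun _ h => h, fun _ h => h⟩

/-- Unfolding an admissible re-lettering into its seven clauses. [folklore] -/
theorem relettering_iff (O : ValuationSubring K) (z z' : Fin n → K) (T : (Fin n → ℤ) → (Fin n → ℤ)) :
    Relettering k O z z' T ↔
      (∀ j, z' j ∈ O) ∧ (∀ j, z' j ≠ 0) ∧
        IntermediateField.adjoin k (Set.range z') = IntermediateField.adjoin k (Set.range z) ∧
        (∀ f, (∏ j, z' j ^ T f j) = ∏ j, z j ^ f j) ∧ (∀ f, T (-f) = -T f) ∧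
        (∀ f : Fin n → ℤ, (∀ j, 0 ≤ f j) → ∀ j, 0 ≤ T f j) ∧ (∀ f : Fin n → ℤ, (∃ j, Odd (f j)) → ∃ j, Odd (T f j)) :=
  Iff.rfl

/-- Transitivity of re-lettering (transformers compose). [folklore] -/
theorem relettering_trans (O : ValuationSubring K) {z z' z'' : Fin n → K} {T T' : (Fin n → ℤ) → (Fin n → ℤ)}
    (h : Relettering k O z z' T) (h' : Relettering k O z' z'' T') : Relettering k O z z'' (T' ∘ T) := by
  obtain ⟨h1, h2, h3, h4, h5, h6, h7⟩ := h
  obtain ⟨h1', h2', h3', h4', h5', h6', h7'⟩ := h'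
  refine ⟨h1', h2', h3'.trans h3, fun f => ?_, fun f => ?_, fun f hf => h6' _ (h6 f hf), fun f hf => h7' _ (h7 f hf)⟩
  · rw [Function.comp_apply, h4', h4]
  · rw [Function.comp_apply, Function.comp_apply, h5, h5']

/-- **One pair blow-up in the orientation dictated by the valuation.** For `a ≠ b` either `z_b/z_a ∈ O` — blow up with pivot `a`
(`z_b = z_a z'_b`, transformer `f ↦ f + f b • δ_a`) — or `z_a/z_b ∈ O` — pivot `b`. OURS. [folklore] -/
theorem relettering_step (O : ValuationSubring K) (z : Fin n → K) (hzO : ∀ j, z j ∈ O) (hz0 : ∀ j, z j ≠ 0)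
    {a b : Fin n} (hab : a ≠ b) :
    (∃ z', Relettering k O z z' (fun f => Function.update f a (f a + f b))) ∨
      (∃ z', Relettering k O z z' (fun f => Function.update f b (f b + f a))) := by
  rcases le_total (O.valuation (z b)) (O.valuation (z a)) with hle | hle
  · left
    have hq : z b / z a ∈ O := by
      rw [← O.valuation_le_one_iff, map_div₀]
      exact div_le_one_of_le₀ hle zero_le
    exact ⟨_, update_div_mem O z hzO hq, update_div_ne_zero z hz0 a b, adjoin_update_div z hz0 hab,
      prod_zpow_update_shift z hz0 hab, shift_neg a b, fun f hf => shift_nonneg a b hf, fun f hf => shift_odd hab hf⟩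
  · right
    have hq : z a / z b ∈ O := by
      rw [← O.valuation_le_one_iff, map_div₀]
      exact div_le_one_of_le₀ hle zero_le
    exact ⟨_, update_div_mem O z hzO hq, update_div_ne_zero z hz0 b a, adjoin_update_div z hz0 hab.symm,
      prod_zpow_update_shift z hz0 hab.symm, shift_neg b a, fun f hf => shift_nonneg b a hf, fun f hf => shift_odd hab.symm hf⟩

end Relettering

end Summit.ResolutionOfSingularities.ResolutionOfSingularities.Theorems.SteerToricVertexSplit

end
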